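import Literature.Analysis.Pluripotential.WirtingerDerivatives
import HarnessLib

/-!
# Invariance of the total Monge–Ampère mass `∫ det (∂∂̄u)` under compactly supported perturbations

Topic `Literature/Analysis/Pluripotential`; step (P6) of the proof of the named fact
`BoucksomEtAl2010_regularMass_le_degree_pow` (`NonPluripolarMongeAmpereMass.lean`), the
Bedford–Taylor-free / Stokes-free form of "the total mass of `(dd^c u)ⁿ` on `ℂⁿ` is computed at
infinity": for `v, ψ : ℂⁿ → ℝ` of class `C^∞` with `ψ` compactly supported,

  `∫_{ℂⁿ} (det Levi(v + ψ) - det Levi(v)) dλ = 0`   (`integral_det_leviMatrix_add_sub`),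

where `Levi u = leviMatrix u` is the complex Hessian `(∂_p∂̄_q u)`. Proof (classical "the cofactor
matrix of a Hessian is divergence free", organised by columns so that no cofactors are needed):

1. `sum_integral_det_updateCol_leviMatrix_eq_zero` — for smooth `u` and compactly supported smooth
   `ψ`, `Σ_q ∫ det(Levi u with column q := column q of Levi ψ) = 0`: column `q` of `Levi ψ` is
   `∂̄_q c`, `c = (∂_p ψ)_p` (`∂̄_q = dbarAlong e_q`, `∂_p = delAlong e_p`); by the Leibniz rule
   along `∂̄_q` and `∫ ∂̄_q(⋯) = 0` (`integral_det_updateCol_dbarAlong`) this is minus the sum over `k ≠ q` of the integrals of the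
   determinants with column `q := c` and column `k := ∂̄_q (column k of Levi u)`; the latter column is
   symmetric in `(q, k)` (`dbarAlong_delAlong_dbarAlong_comm`, third derivatives commute) while the determinant is
   antisymmetric under the swap of the two updated columns (`det_updateCol_updateCol_swap`), so the
   double sum vanishes (`sum_sum_erase_eq_zero_of_antisymm`).
2. Along the pencil `s ↦ v + sψ`, `Levi(v + sψ) = Levi v + s Levi ψ` and
   `d/ds det = Σ_q det(column q := column q of Levi ψ)` (`hasDerivAt_det_add_smul`); the
   integrand and this derivative are continuous, supported in `tsupport ψ` and uniformly bounded
   there, so `∫` may be differentiated under the integral sign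
   (`hasDerivAt_integral_of_dominated_loc_of_deriv_le`) with derivative `0` by step 1
   (`hasDerivAt_integral_pencil`); the integral is constant in `s` and vanishes at `s = 0`.

## References

Standard; e.g. the proof that `∫ (dd^c u)ⁿ` only depends on the values of `u` near infinity for
smooth `u` (E. Bedford, B. A. Taylor, Invent. Math. 37 (1976), §2, smooth case; J.-P. Demailly,
Complex analytic and differential geometry, Ch. III §1). Tagged folklore.
-/

noncomputable section

open scoped Topology ComplexConjugate ContDiff Matrix
open Filter Set Complex MeasureTheory
open Literature.AlgebraicGeometry.HodgeTheory.BiextensionHeight (leviMatrix)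
open Literature.Analysis.Calculus (dirDeriv dirDeriv_apply)
open Literature.Analysis.Complex (dbarAlong delAlong dbarAlong_apply delAlong_apply)

namespace Literature.Analysis.Pluripotential

/-! ### The cancellation mechanism -/

section Cancellation

variable {n : ℕ}

/-- Swapping the two updated columns changes the sign of the determinant. [folklore] -/
theorem det_updateCol_updateCol_swap (M : Matrix (Fin n) (Fin n) ℂ) {q k : Fin n} (hqk : q ≠ k)
    (c S : Fin n → ℂ) :
    ((M.updateCol q c).updateCol k S).det = -((M.updateCol k c).updateCol q S).det := by
  have h : (M.updateCol k c).updateCol q S =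
      ((M.updateCol q c).updateCol k S).submatrix id (Equiv.swap q k) := by
    ext i j
    simp only [Matrix.submatrix_apply, id_eq, Matrix.updateCol_apply]
    by_cases hjq : j = q
    · subst hjq
      simp [Equiv.swap_apply_left]
    · by_cases hjk : j = k
      · subst hjk
        simp [Equiv.swap_apply_right, hjq, hqk]
      · rw [Equiv.swap_apply_of_ne_of_ne hjq hjk]
        simp [hjq, hjk]
  rw [h, Matrix.det_permute', Equiv.Perm.sign_swap hqk]
  simp

/-- Symmetry of the third-order Wirtinger derivatives of the Levi matrix of a smooth function:
`∂̄_q (∂_p ∂̄_k U) = ∂̄_k (∂_p ∂̄_q U)`. [folklore] -/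
theorem dbarAlong_delAlong_dbarAlong_comm {U : (Fin n → ℂ) → ℂ} (hU : ContDiff ℝ ∞ U) (p q k : Fin n) :
    dbarAlong (Pi.single q 1) (delAlong (Pi.single p 1) (dbarAlong (Pi.single k 1) U)) =
      dbarAlong (Pi.single k 1) (delAlong (Pi.single p 1) (dbarAlong (Pi.single q 1) U)) := by
  rw [dbarAlong_delAlong_comm (Complex.contDiff_infty_dbarAlong hU _), dbarAlong_dbarAlong_comm hU (Pi.single q 1),
    ← dbarAlong_delAlong_comm (Complex.contDiff_infty_dbarAlong hU _)]

variable [MeasurableSpace (Fin n → ℂ)] in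
omit [MeasurableSpace (Fin n → ℂ)] in
/-- A determinant with a column vanishing off a compact set has compact support. [folklore] -/
theorem hasCompactSupport_det_of_col {N : (Fin n → ℂ) → Matrix (Fin n) (Fin n) ℂ} (q : Fin n)
    {K : Set (Fin n → ℂ)} (hK : IsCompact K) (hN : ∀ w ∉ K, ∀ i, N w i q = 0) :
    HasCompactSupport fun w ↦ (N w).det := by
  apply HasCompactSupport.of_support_subset_isCompact hK
  intro w hw
  by_contra hwK
  apply hw
  exact Matrix.det_eq_zero_of_column_eq_zero q (hN w hwK)

/-- **One column by parts.** For a smooth matrix function `L` and smooth compactly supported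
functions `c_p`, the integral of `det L` with column `q` replaced by `∂̄_q c` equals minus the sum
over `k ≠ q` of the integrals of `det L` with column `q` replaced by `c` and column `k` replaced by
`∂̄_q` of the `k`-th column of `L` (Leibniz rule along `∂̄_q` and `∫ ∂̄_q = 0`). [folklore] -/
theorem integral_det_updateCol_dbarAlong {L : (Fin n → ℂ) → Matrix (Fin n) (Fin n) ℂ}
    (hL : ∀ i j, ContDiff ℝ ∞ fun w ↦ L w i j) {c : Fin n → (Fin n → ℂ) → ℂ}
    (hc : ∀ p, ContDiff ℝ ∞ (c p)) {K : Set (Fin n → ℂ)} (hK : IsCompact K)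
    (hcK : ∀ p, tsupport (c p) ⊆ K) (q : Fin n) :
    ∫ w, ((L w).updateCol q fun p ↦ dbarAlong (Pi.single q 1) (c p) w).det =
      -∑ k ∈ Finset.univ.erase q,
        ∫ w, (((L w).updateCol q fun p ↦ c p w).updateCol k
          fun p ↦ dbarAlong (Pi.single q 1) (fun w ↦ L w p k) w).det := by
  -- the matrix `N = L` with column `q` replaced by `c`
  set N : (Fin n → ℂ) → Matrix (Fin n) (Fin n) ℂ := fun w ↦ (L w).updateCol q fun p ↦ c p w with hN
  have hNs : ∀ i j, ContDiff ℝ ∞ fun w ↦ N w i j := by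
    intro i j
    simp only [hN, Matrix.updateCol_apply]
    by_cases hj : j = q
    · simp only [hj, if_true]; exact hc i
    · simp only [hj, if_false]; exact hL i j
  have hcz : ∀ p, ∀ w ∉ K, c p w = 0 := fun p w hw ↦ image_eq_zero_of_notMem_tsupport fun h ↦ hw (hcK p h)
  have hdcz : ∀ p, ∀ w ∉ K, dbarAlong (Pi.single q 1) (c p) w = 0 := fun p w hw ↦
    dbarAlong_eq_zero_of_notMem_tsupport _ fun h ↦ hw (hcK p h)
  -- Leibniz along `∂̄_q`
  have hLeib := dbarAlong_det hNs (Pi.single q 1)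
  -- the `k = q` term and the `k ≠ q` terms
  have hsplit : ∀ w, ∑ k, ((N w).updateCol k fun i ↦ dbarAlong (Pi.single q 1) (fun w ↦ N w i k) w).det =
      ((L w).updateCol q fun p ↦ dbarAlong (Pi.single q 1) (c p) w).det +
        ∑ k ∈ Finset.univ.erase q, (((L w).updateCol q fun p ↦ c p w).updateCol k
          fun p ↦ dbarAlong (Pi.single q 1) (fun w ↦ L w p k) w).det := by
    intro w
    rw [← Finset.add_sum_erase _ _ (Finset.mem_univ q)]
    congr 1
    · simp only [hN, Matrix.updateCol_idem]
      congr 2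
      funext i
      simp
    · refine Finset.sum_congr rfl fun k hk ↦ ?_
      have hkq : k ≠ q := Finset.ne_of_mem_erase hk
      simp only [hN]
      congr 2
      funext i
      simp [hkq]
  -- integrability of all terms (continuous with compact support)
  have hcontN : ∀ i j, Continuous fun w ↦ N w i j := fun i j ↦ (hNs i j).continuous
  have hint1 : Integrable fun w ↦ ((L w).updateCol q fun p ↦ dbarAlong (Pi.single q 1) (c p) w).det := by
    apply Continuous.integrable_of_hasCompactSupport
    · refine Continuous.matrix_det (continuous_pi fun i ↦ continuous_pi fun j ↦ ?_)
      simp only [Matrix.updateCol_apply]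
      split_ifs
      · exact (Complex.contDiff_infty_dbarAlong (hc i) _).continuous
      · exact (hL i j).continuous
    · exact hasCompactSupport_det_of_col (N := fun w ↦ (L w).updateCol q fun p ↦ dbarAlong (Pi.single q 1) (c p) w)
        q hK fun w hw i ↦ by simp [hdcz i w hw]
  have hint2 : ∀ k ∈ Finset.univ.erase q, Integrable fun w ↦
      (((L w).updateCol q fun p ↦ c p w).updateCol k fun p ↦ dbarAlong (Pi.single q 1) (fun w ↦ L w p k) w).det := by
    intro k hk
    have hkq : k ≠ q := Finset.ne_of_mem_erase hk
    apply Continuous.integrable_of_hasCompactSupport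
    · refine Continuous.matrix_det (continuous_pi fun i ↦ continuous_pi fun j ↦ ?_)
      simp only [Matrix.updateCol_apply]
      split_ifs
      · exact (Complex.contDiff_infty_dbarAlong (hL i k) _).continuous
      · exact (hc i).continuous
      · exact (hL i j).continuous
    · have hcol : ∀ w ∉ K, ∀ i, (((L w).updateCol q fun p ↦ c p w).updateCol k
          fun p ↦ dbarAlong (Pi.single q 1) (fun w ↦ L w p k) w) i q = 0 := by
        intro w hw i
        rw [Matrix.updateCol_ne hkq.symm, Matrix.updateCol_self]
        exact hcz i w hw
      exact hasCompactSupport_det_of_col q hK hcol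
  -- `∫ ∂̄_q det N = 0`
  have hzero : ∫ w, dbarAlong (Pi.single q 1) (fun w ↦ (N w).det) w = 0 := by
    have hdetN : ContDiff ℝ ∞ fun w ↦ (N w).det := contDiff_det hNs
    have hsuppN : HasCompactSupport fun w ↦ (N w).det :=
      hasCompactSupport_det_of_col (N := N) q hK fun w hw i ↦ by simp [hN, hcz i w hw]
    simp only [dbarAlong_eq_div]
    rw [integral_div, integral_add, integral_const_mul, integral_dirDeriv_eq_zero hdetN hsuppN,
      integral_dirDeriv_eq_zero hdetN hsuppN]
    · simp
    · exact ((contDiff_dirDeriv hdetN _).continuous).integrable_of_hasCompactSupport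
        (hasCompactSupport_dirDeriv hsuppN _)
    · exact (((contDiff_dirDeriv hdetN _).continuous).integrable_of_hasCompactSupport
        (hasCompactSupport_dirDeriv hsuppN _)).const_mul I
  rw [hLeib] at hzero
  simp only [hsplit] at hzero
  rw [integral_add hint1 (integrable_finsetSum _ hint2), integral_finsetSum _ hint2] at hzero
  linear_combination hzero

end Cancellation


/-! ### The main identity -/

section Main

variable {n : ℕ}

/-- `tsupport (ψ : ℂ) = tsupport ψ` for real `ψ`. [folklore] -/
theorem tsupport_ofReal_comp (ψ : (Fin n → ℂ) → ℝ) :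
    tsupport (fun w ↦ (ψ w : ℂ)) = tsupport ψ := by
  simp only [tsupport]
  congr 1
  ext w
  simp

/-- An antisymmetric kernel sums to zero off the diagonal. [folklore] -/
theorem sum_sum_erase_eq_zero_of_antisymm (Y : Fin n → Fin n → ℂ)
    (h : ∀ q k, q ≠ k → Y q k = -Y k q) :
    ∑ q, ∑ k ∈ Finset.univ.erase q, Y q k = 0 := by
  have swap : ∀ f : Fin n → Fin n → ℂ,
      ∑ q, ∑ k ∈ Finset.univ.erase q, f q k = ∑ k, ∑ q ∈ Finset.univ.erase k, f q k := by
    intro f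
    have h1 : ∀ q, ∑ k ∈ Finset.univ.erase q, f q k = ∑ k, f q k - f q q := fun q ↦ by
      rw [Finset.sum_erase_eq_sub (Finset.mem_univ q)]
    have h2 : ∀ k, ∑ q ∈ Finset.univ.erase k, f q k = ∑ q, f q k - f k k := fun k ↦ by
      rw [Finset.sum_erase_eq_sub (Finset.mem_univ k)]
    simp only [h1, h2, Finset.sum_sub_distrib]
    rw [Finset.sum_comm]
  have key : ∑ q, ∑ k ∈ Finset.univ.erase q, Y q k = -∑ q, ∑ k ∈ Finset.univ.erase q, Y q k := by
    calc ∑ q, ∑ k ∈ Finset.univ.erase q, Y q k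
        = ∑ q, ∑ k ∈ Finset.univ.erase q, -Y k q := by
          refine Finset.sum_congr rfl fun q _ ↦ Finset.sum_congr rfl fun k hk ↦ ?_
          exact h q k (Finset.ne_of_mem_erase hk).symm
      _ = -∑ q, ∑ k ∈ Finset.univ.erase q, Y k q := by
          simp only [Finset.sum_neg_distrib]
      _ = -∑ k, ∑ q ∈ Finset.univ.erase k, Y k q := by rw [swap (fun q k ↦ Y k q)]
      _ = -∑ q, ∑ k ∈ Finset.univ.erase q, Y q k := rfl
  have h2 : (2 : ℂ) * ∑ q, ∑ k ∈ Finset.univ.erase q, Y q k = 0 := by linear_combination key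
  exact (mul_eq_zero.mp h2).resolve_left two_ne_zero

/-- **The column expansion of the first variation of `∫ det (Levi u)` vanishes.** For `u, ψ : ℂⁿ → ℝ`
of class `C^∞`, `ψ` with compact support,
`Σ_q ∫ det(Levi u with column q replaced by column q of Levi ψ) dλ = 0`:
writing the columns through Wirtinger derivatives, column `q` of `Levi ψ` is `∂̄_q c` with
`c = (∂_p ψ)_p`; integrating `∂̄_q` by parts produces the terms with column `q` equal to `c` and
column `k` equal to `∂̄_q` of column `k` of `Levi u`, symmetric in `(q, k)`, while the determinant
is antisymmetric under the column swap. [folklore] -/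
theorem sum_integral_det_updateCol_leviMatrix_eq_zero {u ψ : (Fin n → ℂ) → ℝ}
    (hu : ContDiff ℝ ∞ u) (hψ : ContDiff ℝ ∞ ψ) (hψc : HasCompactSupport ψ) :
    ∑ q, ∫ w, ((leviMatrix u w).updateCol q fun p ↦ leviMatrix ψ w p q).det = 0 := by
  set U : (Fin n → ℂ) → ℂ := fun w ↦ (u w : ℂ) with hUdef
  set Ψ : (Fin n → ℂ) → ℂ := fun w ↦ (ψ w : ℂ) with hΨdef
  have hU : ContDiff ℝ ∞ U := ofRealCLM.contDiff.comp hu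
  have hΨ : ContDiff ℝ ∞ Ψ := ofRealCLM.contDiff.comp hψ
  set L : (Fin n → ℂ) → Matrix (Fin n) (Fin n) ℂ :=
    fun w ↦ Matrix.of fun p k ↦ delAlong (Pi.single p 1) (dbarAlong (Pi.single k 1) U) w with hLdef
  have hL : ∀ i j, ContDiff ℝ ∞ fun w ↦ L w i j := fun i j ↦
    contDiff_delAlong_top (Complex.contDiff_infty_dbarAlong hU _) _
  have hLu : ∀ w, leviMatrix u w = L w := fun w ↦ by
    ext p k
    simp only [hLdef, Matrix.of_apply]
    exact leviMatrix_eq_delAlong_dbarAlong hu w p k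
  set c : Fin n → (Fin n → ℂ) → ℂ := fun p ↦ delAlong (Pi.single p 1) Ψ with hcdef
  have hc : ∀ p, ContDiff ℝ ∞ (c p) := fun p ↦ contDiff_delAlong_top hΨ _
  have hK : IsCompact (tsupport ψ) := hψc
  have hcK : ∀ p, tsupport (c p) ⊆ tsupport ψ := fun p ↦
    (tsupport_delAlong_subset _ Ψ).trans (tsupport_ofReal_comp ψ).le
  -- column `q` of `Levi ψ` is `∂̄_q c`
  have hcol : ∀ w q, (fun p ↦ leviMatrix ψ w p q) = fun p ↦ dbarAlong (Pi.single q 1) (c p) w := by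
    intro w q; funext p
    rw [leviMatrix_eq_delAlong_dbarAlong hψ]
    exact (congr_fun (dbarAlong_delAlong_comm hΨ (Pi.single q 1) (Pi.single p 1)) w).symm
  -- one column by parts
  have hA : ∀ q, ∫ w, ((L w).updateCol q fun p ↦ dbarAlong (Pi.single q 1) (c p) w).det =
      -∑ k ∈ Finset.univ.erase q, ∫ w, (((L w).updateCol q fun p ↦ c p w).updateCol k
        fun p ↦ dbarAlong (Pi.single q 1) (fun w ↦ L w p k) w).det := fun q ↦
    integral_det_updateCol_dbarAlong hL hc hK hcK q
  -- symmetry of the third derivatives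
  have hS : ∀ q k w, (fun p ↦ dbarAlong (Pi.single q 1) (fun w ↦ L w p k) w) = fun p ↦ dbarAlong (Pi.single k 1) (fun w ↦ L w p q) w := by
    intro q k w; funext p
    simp only [hLdef, Matrix.of_apply]
    exact congr_fun (dbarAlong_delAlong_dbarAlong_comm hU p q k) w
  -- antisymmetry of the double integrals
  set Y : Fin n → Fin n → ℂ := fun q k ↦ ∫ w, (((L w).updateCol q fun p ↦ c p w).updateCol k
    fun p ↦ dbarAlong (Pi.single q 1) (fun w ↦ L w p k) w).det with hY
  have hanti : ∀ q k, q ≠ k → Y q k = -Y k q := by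
    intro q k hqk
    simp only [hY]
    rw [← integral_neg]
    congr 1
    funext w
    rw [det_updateCol_updateCol_swap (L w) hqk, hS q k w]
  calc ∑ q, ∫ w, ((leviMatrix u w).updateCol q fun p ↦ leviMatrix ψ w p q).det
      = ∑ q, ∫ w, ((L w).updateCol q fun p ↦ dbarAlong (Pi.single q 1) (c p) w).det := by
        simp_rw [hLu, hcol]
    _ = ∑ q, -∑ k ∈ Finset.univ.erase q, Y q k := by simp_rw [hA]; rfl
    _ = -∑ q, ∑ k ∈ Finset.univ.erase q, Y q k := by rw [Finset.sum_neg_distrib]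
    _ = 0 := by rw [sum_sum_erase_eq_zero_of_antisymm Y hanti, neg_zero]

end Main


/-! ### Invariance of `∫ det (Levi ·)` under compactly supported perturbations -/

section Invariance

variable {n : ℕ}

/-- Joint continuity of the column-expanded derivative along the pencil `Levi v + s Levi ψ`.
[folklore] -/
theorem continuous_pencil_deriv {v ψ : (Fin n → ℂ) → ℝ} (hv : ContDiff ℝ ∞ v)
    (hψ : ContDiff ℝ ∞ ψ) :
    Continuous fun x : ℝ × (Fin n → ℂ) ↦ ∑ k,
      ((leviMatrix v x.2 + (x.1 : ℂ) • leviMatrix ψ x.2).updateCol k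
        fun i ↦ leviMatrix ψ x.2 i k).det := by
  refine continuous_finsetSum _ fun k _ ↦ Continuous.matrix_det ?_
  refine continuous_pi fun i ↦ continuous_pi fun j ↦ ?_
  simp only [Matrix.updateCol_apply, Matrix.add_apply, Matrix.smul_apply, smul_eq_mul]
  split_ifs
  · exact (continuous_leviMatrix_apply hψ i k).comp continuous_snd
  · exact ((continuous_leviMatrix_apply hv i j).comp continuous_snd).add
      ((continuous_ofReal.comp continuous_fst).mul
        ((continuous_leviMatrix_apply hψ i j).comp continuous_snd))

/-- Continuity in `w` of the pencil integrand `det(Levi v + s Levi ψ) - det(Levi v)`. [folklore] -/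
theorem continuous_pencil {v ψ : (Fin n → ℂ) → ℝ} (hv : ContDiff ℝ ∞ v) (hψ : ContDiff ℝ ∞ ψ)
    (s : ℝ) : Continuous fun w ↦
      (leviMatrix v w + (s : ℂ) • leviMatrix ψ w).det - (leviMatrix v w).det := by
  refine (Continuous.matrix_det ?_).sub (Continuous.matrix_det ?_)
  · refine continuous_pi fun i ↦ continuous_pi fun j ↦ ?_
    simp only [Matrix.add_apply, Matrix.smul_apply, smul_eq_mul]
    exact (continuous_leviMatrix_apply hv i j).add
      (continuous_const.mul (continuous_leviMatrix_apply hψ i j))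
  · exact continuous_pi fun i ↦ continuous_pi fun j ↦ continuous_leviMatrix_apply hv i j

/-- The pencil integrand vanishes off `tsupport ψ`. [folklore] -/
theorem pencil_eq_zero {v ψ : (Fin n → ℂ) → ℝ} (s : ℝ) {w : Fin n → ℂ} (hw : w ∉ tsupport ψ) :
    (leviMatrix v w + (s : ℂ) • leviMatrix ψ w).det - (leviMatrix v w).det = 0 := by
  rw [leviMatrix_eq_zero_of_notMem_tsupport hw, smul_zero, add_zero, sub_self]

/-- The column-expanded derivative vanishes off `tsupport ψ`. [folklore] -/
theorem pencil_deriv_eq_zero {v ψ : (Fin n → ℂ) → ℝ} (s : ℝ) {w : Fin n → ℂ}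
    (hw : w ∉ tsupport ψ) :
    ∑ k, ((leviMatrix v w + (s : ℂ) • leviMatrix ψ w).updateCol k
      fun i ↦ leviMatrix ψ w i k).det = 0 := by
  refine Finset.sum_eq_zero fun k _ ↦ Matrix.det_eq_zero_of_column_eq_zero k fun i ↦ ?_
  rw [Matrix.updateCol_self, leviMatrix_eq_zero_of_notMem_tsupport hw, Matrix.zero_apply]

/-- The pencil integrand is integrable. [folklore] -/
theorem integrable_pencil {v ψ : (Fin n → ℂ) → ℝ} (hv : ContDiff ℝ ∞ v) (hψ : ContDiff ℝ ∞ ψ)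
    (hψc : HasCompactSupport ψ) (s : ℝ) : Integrable fun w ↦
      (leviMatrix v w + (s : ℂ) • leviMatrix ψ w).det - (leviMatrix v w).det :=
  (continuous_pencil hv hψ s).integrable_of_hasCompactSupport
    (HasCompactSupport.of_support_subset_isCompact hψc fun _ hw ↦ by_contra fun h ↦
      hw (pencil_eq_zero s h))

/-- **The integrated column expansion vanishes** along the pencil. [folklore] -/
theorem integral_pencil_deriv_eq_zero {v ψ : (Fin n → ℂ) → ℝ} (hv : ContDiff ℝ ∞ v)
    (hψ : ContDiff ℝ ∞ ψ) (hψc : HasCompactSupport ψ) (s : ℝ) :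
    ∫ w, ∑ k, ((leviMatrix v w + (s : ℂ) • leviMatrix ψ w).updateCol k
      fun i ↦ leviMatrix ψ w i k).det = 0 := by
  have hint : ∀ k ∈ Finset.univ, Integrable fun w ↦
      ((leviMatrix v w + (s : ℂ) • leviMatrix ψ w).updateCol k fun i ↦ leviMatrix ψ w i k).det := by
    intro k _
    apply Continuous.integrable_of_hasCompactSupport
    · refine Continuous.matrix_det (continuous_pi fun i ↦ continuous_pi fun j ↦ ?_)
      simp only [Matrix.updateCol_apply, Matrix.add_apply, Matrix.smul_apply, smul_eq_mul]
      split_ifs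
      · exact continuous_leviMatrix_apply hψ i k
      · exact (continuous_leviMatrix_apply hv i j).add
          (continuous_const.mul (continuous_leviMatrix_apply hψ i j))
    · refine HasCompactSupport.of_support_subset_isCompact hψc fun w hw ↦ by_contra fun h ↦ hw ?_
      refine Matrix.det_eq_zero_of_column_eq_zero k fun i ↦ ?_
      rw [Matrix.updateCol_self, leviMatrix_eq_zero_of_notMem_tsupport h, Matrix.zero_apply]
  rw [integral_finsetSum _ hint]
  have key := sum_integral_det_updateCol_leviMatrix_eq_zero (u := v + s • ψ)
    (by exact hv.add (hψ.const_smul s)) hψ hψc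
  simp only [leviMatrix_add_smul hv hψ s] at key
  exact key

/-- **Differentiation under the integral sign along the pencil**: the `s`-derivative of
`∫ (det Levi(v + sψ) - det Levi v)` is the (vanishing) integrated column expansion. [folklore] -/
theorem hasDerivAt_integral_pencil {v ψ : (Fin n → ℂ) → ℝ} (hv : ContDiff ℝ ∞ v)
    (hψ : ContDiff ℝ ∞ ψ) (hψc : HasCompactSupport ψ) (s₀ : ℝ) :
    HasDerivAt (fun s : ℝ ↦ ∫ w,
      ((leviMatrix v w + (s : ℂ) • leviMatrix ψ w).det - (leviMatrix v w).det)) 0 s₀ := by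
  have hK : IsCompact (tsupport ψ) := hψc
  obtain ⟨C, hC⟩ := ((isCompact_closedBall s₀ 1).prod hK).exists_bound_of_continuousOn
    (continuous_pencil_deriv hv hψ).continuousOn
  have key := hasDerivAt_integral_of_dominated_loc_of_deriv_le (μ := volume)
    (F := fun (s : ℝ) (w : Fin n → ℂ) ↦
      (leviMatrix v w + (s : ℂ) • leviMatrix ψ w).det - (leviMatrix v w).det)
    (F' := fun (s : ℝ) (w : Fin n → ℂ) ↦ ∑ k, ((leviMatrix v w + (s : ℂ) • leviMatrix ψ w).updateCol k
      fun i ↦ leviMatrix ψ w i k).det)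
    (x₀ := s₀) (bound := (tsupport ψ).indicator fun _ ↦ C) (s := Metric.ball s₀ 1)
    (Metric.ball_mem_nhds s₀ zero_lt_one)
    (Eventually.of_forall fun s ↦ (continuous_pencil hv hψ s).aestronglyMeasurable)
    (integrable_pencil hv hψ hψc s₀)
    ((continuous_pencil_deriv hv hψ).comp (Continuous.prodMk_right s₀)).aestronglyMeasurable
    ?_ ?_ ?_
  · rw [integral_pencil_deriv_eq_zero hv hψ hψc s₀] at key
    exact key.2
  · refine Eventually.of_forall fun w s hs ↦ ?_
    by_cases hw : w ∈ tsupport ψ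
    · rw [Set.indicator_of_mem hw]
      exact hC (s, w) ⟨Metric.ball_subset_closedBall hs, hw⟩
    · rw [Set.indicator_of_notMem hw, pencil_deriv_eq_zero s hw, norm_zero]
  · exact (integrableOn_const (hK.measure_lt_top.ne)).integrable_indicator hK.measurableSet
  · refine Eventually.of_forall fun w s _ ↦ ?_
    exact (hasDerivAt_det_add_smul (leviMatrix v w) (leviMatrix ψ w) s).sub_const _

/-- **`∫ det Levi(v + ψ) = ∫ det Levi(v)` for `ψ` smooth with compact support** (`v` smooth; no
integrability of `det Levi(v)` itself is needed in this difference form): the derivative in `s` of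
`∫ (det Levi(v + sψ) - det Levi(v))` is the vanishing column expansion
`sum_integral_det_updateCol_leviMatrix_eq_zero`, so the integral is constant in `s`, and it
vanishes at `s = 0`. This is the (Bedford–Taylor-free, smooth) statement that the total
Monge–Ampère mass `∫ (dd^c u)^n` only depends on the behaviour of `u` at infinity. [folklore] -/
theorem integral_det_leviMatrix_add_sub (v ψ : (Fin n → ℂ) → ℝ) (hv : ContDiff ℝ ∞ v)
    (hψ : ContDiff ℝ ∞ ψ) (hψc : HasCompactSupport ψ) :
    ∫ w, ((leviMatrix (v + ψ) w).det - (leviMatrix v w).det) = 0 := by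
  have hderiv := hasDerivAt_integral_pencil hv hψ hψc
  have hconst := is_const_of_deriv_eq_zero
    (f := fun s : ℝ ↦ ∫ w, ((leviMatrix v w + (s : ℂ) • leviMatrix ψ w).det - (leviMatrix v w).det))
    (fun s ↦ (hderiv s).differentiableAt) (fun s ↦ (hderiv s).deriv) 1 0
  have h1 : ∀ w, leviMatrix (v + ψ) w = leviMatrix v w + ((1 : ℝ) : ℂ) • leviMatrix ψ w := by
    intro w
    rw [← leviMatrix_add_smul hv hψ 1 w, one_smul]
  simp only [h1]
  rw [hconst]
  simp

end Invariance

end Literature.Analysis.Pluripotential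

end
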